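import Summits.ABC.ABC.Theorems.TwistAmplificationSharpModerateLawCoreDefs
import Summits.ABC.ABC.Theorems.TwistAmplificationSharpModerateLawCuspCoordinates

/-!
# Crux `TwistAmplification.SharpModerateLaw` (stmt-ABC-1975): objects of the TWIST-ORBIT INVERSION of the core

Lead `prover-line-stmt-ABC-1975-c6-0` (ninth lead seat), 2026-08-17, after the crux-strategist's census
(`Cruxes/SharpModerateLaw/STRATEGY-CENSUS.md`, `…/TwistMinimalSplit.lean`, planner-cstrat-stmt-ABC-1975-p1-0).

Every line of the crux reduces to the canonical core `CoreLaw` (`…CoreDefs.lean`; `sharpModerateLaw_of_coreLaw`,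
`abc_of_coreLaw`). The route's amplification mechanism (quadratic twists) is exactly invertible in cusp coordinates:
a tower-free pair `y = (c₄, c₆)` is `d ⋆ x := (d²u, d³v)` (`twistPair`) for a unique squarefree `d` with all prime
factors `≥ 5` (the product of its TWISTING primes `p ≥ 5`: `p² ∣ c₄`, `p³ ∣ c₆`, `v_p(c₄³ − c₆²) = 6`, i.e. Kodaira type
`I₀*`) and a unique TWIST-MINIMAL `x` (`IsTwistMinimal`: no twisting prime), and then `M⁺(y) = d⁶ M⁺(x)`,
`N5cusp(y) = d² N5cusp(x)`. This file types (definitions and two one-line calibrations only; the proofs are the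
registered stubs of the lead's skeleton v5 and live in the accompanying proof files):

* `IsTwistMinimal`, `twistPair`;
* `CoreLawTM` — the core law on twist-minimal pairs (the STATISTICAL summand; formally below `CoreLaw`:
  `coreLawTM_of_coreLaw`);
* `PointwiseSzpiroCusp` — generalized Szpiro in cusp coordinates with the conductor proxy `N5cusp` (the POINTWISE
  summand; `↔ ABC`, proof files);
* the implication-shaped stub statements `TwistDecomposition`, `TwistScaling` (the inversion dictionary) and
  `TwistOrbitInversion : CoreLawTM → PointwiseSzpiroCusp → CoreLaw`.

Statements `IsTwistMinimal`, `CoreLawTM`, `PointwiseSzpiroCusp`, `TwistOrbitInversion`, `twistPair` are VERBATIM the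
strategist's (so the crux-side split children stay `Iff.rfl`-equal to these).
-/

noncomputable section

-- the mandated summit namespace `Summit.ABC.ABC` (summit = problem) trips the duplicate-namespace linter
set_option linter.dupNamespace false

namespace Summit.ABC.ABC.Theorems.SharpModerateLaw

/-- **Twist-minimality** of a cusp pair `(c₄, c₆)`: no prime `p ≥ 5` is a twisting (`I₀*`) prime, i.e. whenever
`p² ∣ c₄` and `p³ ∣ c₆` the discriminant is deeper than a bare twist: `p⁷ ∣ c₄³ − c₆²`. -/
def IsTwistMinimal (x : ℤ × ℤ) : Prop :=
  ∀ p : ℕ, p.Prime → 5 ≤ p → (p : ℤ) ^ 2 ∣ x.1 → (p : ℤ) ^ 3 ∣ x.2 → (p : ℤ) ^ 7 ∣ x.1 ^ 3 - x.2 ^ 2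

/-- The twist action on cusp pairs: `d ⋆ (u, v) = (d²u, d³v)` (the quadratic twist by `d` in `(c₄, c₆)` coordinates). -/
def twistPair (d : ℤ) (x : ℤ × ℤ) : ℤ × ℤ := (d ^ 2 * x.1, d ^ 3 * x.2)

/-- **`CoreLawTM` — the canonical core on twist-minimal pairs** (the statistical summand of the crux): for all
`3 < κ₀ < σ` and `ε > 0` there is `C` with `#(cuspShell(X, Y) ∩ twist-minimal) ≤ C·(XY)^ε·(X·Y^{-1/6} + 1)` whenever
`X^{κ₀} ≤ Y ≤ X^σ`. Same shape as `CoreLaw`, one membership clause more. OPEN (it contains the Mazur–Kane window law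
through the Frey pairs, which are twist-minimal). -/
def CoreLawTM : Prop :=
  ∀ κ₀ σ : ℝ, 3 < κ₀ → κ₀ < σ → ∀ ε : ℝ, 0 < ε → ∃ C : ℝ, ∀ X Y : ℝ, 1 ≤ X → 1 ≤ Y → X ^ κ₀ ≤ Y → Y ≤ X ^ σ →
    (Set.ncard {x : ℤ × ℤ | x ∈ cuspShell X Y ∧ IsTwistMinimal x} : ℝ) ≤
      C * (X * Y) ^ ε * (X * Y ^ (-(1 / 6 : ℝ)) + 1)

/-- **`PointwiseSzpiroCusp` — generalized Szpiro in cusp coordinates** (the pointwise summand of the crux): for every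
`η > 0` there is `C` with `M⁺(c₄, c₆) ≤ C · N5cusp(c₄, c₆)^{6+η}` for every tower-free pair with `c₄c₆ ≠ 0`, `c₄³ ≠ c₆²`,
`1728 ∣ c₄³ − c₆²`. Equivalent to `ABC` (Bombieri–Gubler 12.5.12 with the proxy `N5cusp` in place of the conductor;
proof files `…TwistMinimalPointwise.lean`). -/
def PointwiseSzpiroCusp : Prop :=
  ∀ η : ℝ, 0 < η → ∃ C : ℝ, ∀ x : ℤ × ℤ, x.1 ≠ 0 → x.2 ≠ 0 → x.1 ^ 3 ≠ x.2 ^ 2 → (1728 : ℤ) ∣ x.1 ^ 3 - x.2 ^ 2 →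
    TF x → (Mcusp x : ℝ) ≤ C * (N5cusp x : ℝ) ^ (6 + η)

/-- **`TwistDecomposition`** (stub statement; elementary): every tower-free pair `x` with `x.1³ ≠ x.2²`, `1728 ∣ x.1³ − x.2²`
is a twist `d ⋆ x'` of a twist-minimal tower-free pair `x'` with `1728 ∣ x'.1³ − x'.2²` by a squarefree `d ≥ 1` all of whose
prime factors are `≥ 5` and do not divide `x'.1³ − x'.2²` (`d` = the product of the twisting primes of `x`,
`x' = (x.1/d², x.2/d³)`; for `p ∣ d`, `v_p(x.1³ − x.2²) = 6 = v_p(d⁶)`). -/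
def TwistDecomposition : Prop :=
  ∀ x : ℤ × ℤ, x.1 ^ 3 ≠ x.2 ^ 2 → (1728 : ℤ) ∣ x.1 ^ 3 - x.2 ^ 2 → TF x →
    ∃ (d : ℕ) (x' : ℤ × ℤ), 1 ≤ d ∧ Squarefree d ∧
      (∀ p : ℕ, p.Prime → p ∣ d → 5 ≤ p ∧ ¬ (p : ℤ) ∣ x'.1 ^ 3 - x'.2 ^ 2) ∧
      x = twistPair d x' ∧ IsTwistMinimal x' ∧ TF x' ∧ (1728 : ℤ) ∣ x'.1 ^ 3 - x'.2 ^ 2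

/-- **`TwistScaling`** (stub statement; elementary): for `d ≥ 1` squarefree with all prime factors `≥ 5` and prime to
`x'.1³ − x'.2² ≠ 0`, and `1728 ∣ x'.1³ − x'.2²`, the invariants of the twist scale exactly:
`Mcusp (d ⋆ x') = d⁶ · Mcusp x'` and `N5cusp (d ⋆ x') = d² · N5cusp x'` (every `p ∣ d` is charged `p²`, as an additive prime). -/
def TwistScaling : Prop :=
  ∀ (d : ℕ) (x' : ℤ × ℤ), 1 ≤ d → Squarefree d →
    (∀ p : ℕ, p.Prime → p ∣ d → 5 ≤ p ∧ ¬ (p : ℤ) ∣ x'.1 ^ 3 - x'.2 ^ 2) →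
      x'.1 ^ 3 ≠ x'.2 ^ 2 → (1728 : ℤ) ∣ x'.1 ^ 3 - x'.2 ^ 2 →
      Mcusp (twistPair d x') = d ^ 6 * Mcusp x' ∧ N5cusp (twistPair d x') = d ^ 2 * N5cusp x'

/-- **`TwistOrbitInversion`** (stub statement; elementary counting): the twist-minimal core law and pointwise Szpiro give the
full core law back — sum `CoreLawTM` over the twist parameter `d` at `(X/d², Y/d⁶)` (the cone's lower edge survives because
`κ₀ ≥ 3`; up to the cap `Y/d⁶ ≤ (X/d²)^{6+2η}` the main terms sum to `X·Y^{-1/6}·(1 + log X)` and the `+1` terms to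
`≤ X·Y^{-1/6}·(XY)^{η/9}`; beyond the cap pointwise Szpiro at `η` bounds `N5cusp`, hence `M⁺`, hence `d`: `O(1)`). -/
def TwistOrbitInversion : Prop :=
  CoreLawTM → PointwiseSzpiroCusp → CoreLaw

/-- The discriminant numerator scales by `d⁶` under the twist action. -/
theorem twistPair_cube_sub_sq (d : ℤ) (x : ℤ × ℤ) :
    (twistPair d x).1 ^ 3 - (twistPair d x).2 ^ 2 = d ^ 6 * (x.1 ^ 3 - x.2 ^ 2) := by
  simp only [twistPair]; ring

/-- `CoreLaw → CoreLawTM`: the statistical summand is formally weaker than the core (a sub-count of a finite shell). -/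
theorem coreLawTM_of_coreLaw : CoreLaw → CoreLawTM := by
  intro h κ₀ σ hκ₀ hκσ ε hε
  obtain ⟨C, hC⟩ := h κ₀ σ hκ₀ hκσ ε hε
  refine ⟨C, fun X Y hX hY hlo hhi => le_trans ?_ (hC X Y hX hY hlo hhi)⟩
  exact_mod_cast Set.ncard_le_ncard (fun x (hx : x ∈ cuspShell X Y ∧ IsTwistMinimal x) => hx.1)
    (cuspShell_finite_holds X Y)

/-- A twist by `d` with a prime factor `p ≥ 5`, `p² ∤ d`, `p ∤ u³ − v²`, is never twist-minimal: the twists produced by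
the route's amplification lemma leave the twist-minimal population (why `CoreLawTM` is blind to amplification). -/
theorem not_isTwistMinimal_twistPair {p : ℕ} (hp : p.Prime) (h5 : 5 ≤ p) {d : ℤ} (hpd : (p : ℤ) ∣ d) (x : ℤ × ℤ)
    (hx : ¬ (p : ℤ) ∣ x.1 ^ 3 - x.2 ^ 2) (hd : ¬ (p : ℤ) ^ 2 ∣ d) : ¬ IsTwistMinimal (twistPair d x) := by
  intro htm
  have hp' : Prime (p : ℤ) := Nat.prime_iff_prime_int.mp hp
  obtain ⟨e, rfl⟩ := hpd
  have h2 : (p : ℤ) ^ 2 ∣ (twistPair (p * e) x).1 := ⟨e ^ 2 * x.1, by simp only [twistPair]; ring⟩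
  have h3 : (p : ℤ) ^ 3 ∣ (twistPair (p * e) x).2 := ⟨e ^ 3 * x.2, by simp only [twistPair]; ring⟩
  have h7 := htm p hp h5 h2 h3
  rw [twistPair_cube_sub_sq] at h7
  have hpe : ¬ (p : ℤ) ∣ e := by
    rintro ⟨f, rfl⟩; exact hd ⟨f, by ring⟩
  have : (p : ℤ) ∣ e ^ 6 * (x.1 ^ 3 - x.2 ^ 2) := by
    have h7' : (p : ℤ) ^ 6 * (p : ℤ) ∣ (p : ℤ) ^ 6 * (e ^ 6 * (x.1 ^ 3 - x.2 ^ 2)) := by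
      have : (p * e : ℤ) ^ 6 * (x.1 ^ 3 - x.2 ^ 2) = (p : ℤ) ^ 6 * (e ^ 6 * (x.1 ^ 3 - x.2 ^ 2)) := by ring
      rw [← pow_succ, ← this]; exact h7
    exact (mul_dvd_mul_iff_left (pow_ne_zero 6 hp'.ne_zero)).mp h7'
  rcases hp'.dvd_or_dvd this with h | h
  · exact hpe (hp'.dvd_of_dvd_pow h)
  · exact hx h

end Summit.ABC.ABC.Theorems.SharpModerateLaw

end
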